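import Summits.CriticalPhenomena.PercolationContinuityZ3.Theorems.SahiMasterFamilyUCBernsteinNested
import Summits.CriticalPhenomena.PercolationContinuityZ3.Theorems.SahiMasterFamilyPhiScale

/-!
# The UPPER BOUND `P_T ≤_B (|T|−1)!·β_T` for the edge polynomial of EVERY pair of union-closed families, every order,
# and the doubly-top-free SIGN LAW `P_T ≤_B 0` — via the defect identity in Sahi's square-free generating function

Unit `prim-masterthm-p4` (gen 22; crux anchor stmt-CriticalPhenomena-4575, helper work; memo
`run/shared/lean/prim/prim-masterthm/prim-masterthm-p4/P4-GEN22-REPORT.md` §1(g)).  Companion of `…UCBernsteinNested` (conjecture (B) for pairs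
with the disjoint-union condition; ray positivity `bpos_phiSet_ray`) and of `…PhiScale` (Sahi's generating function `Z_β = ∏_S (1 − Σ_{i∈S} t_i)^{realW β(S)}`
in the square-free algebra, `[t^τ](1 − Z_β) = Φ_τ(β|_τ)`).

For union-closed `𝒰, 𝒱` (no top condition) and the mixture `β_w = w·1_𝒰 + (1−w)·1_𝒱` write `P(w) = Φ_{n+1}(β_w)`.
* `Zf_add` — **the defect identity at the level of generating functions**: `Z_{a+b} = Z_a · Z_b` (exponent law of `binomB`; the weight `realW`
  is linear), hence (`phiSet_add_eq`) `Φ_{n+1}(a+b) = Φ_{n+1}(a) + Φ_{n+1}(b) − Σ_{∅≠σ⊊univ} Φ_σ(a|_σ)·Φ_{σᶜ}(b|_{σᶜ})`, the restricted functionals being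
  honest sub-functionals along enumerations of `σ` and `σᶜ`.
* `bpos_top_sub_ray` — single family: `n!·w·[univ∈𝒰] − Φ_{n+1}(w·1_𝒰)` is `BPos (n+1)` (block expansion of `…BernsteinPos` + ray positivity of the
  restricted families).
* **THEOREM `bpos_top_sub_phiSet_mix` (every order, every pair): `w ↦ n!·β_w(univ) − P(w)` is `BPos (n+1)`** — all degree-`(n+1)` Bernstein
  coefficients of `(|T|−1)!·(w[T∈𝒰] + (1−w)[T∈𝒱]) − P_T(w)` are `≥ 0`; equivalently (block expansion) the `β`-weighted sum of ALL restricted pair polynomials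
  below a root, `Σ_{B∋z, B⊊T} (|B|−1)!·β_B·P_{T∖B}`, is Bernstein-nonnegative although its doubly-top-free terms are `≤_B 0`.  With conjecture (B) this is the
  sandwich `0 ≤_B P_T ≤_B (|T|−1)!·β_T` (lower half open in general; proved for rootable pairs in `…UCBernsteinRootable`).
* **COROLLARY `bpos_neg_phiSet_mix_of_topFree` (the doubly-top-free SIGN LAW, every order): if `univ ∉ 𝒰 ∪ 𝒱` then `−P` is `BPos (n+1)`** — the
  negative half of the hereditary sign law of memo §1(a), so far only on paper.
HONEST FRAMING: conjecture (B) for general pairs, `UCHullNonneg k` (k ≥ 8), Sahi's `C_k` and the master theorem remain OPEN.  Axioms standard. [this work]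
-/

noncomputable section

open scoped Classical

open private binomB_mul_binomB_same binomB_zero_right isNil_one_sub_binomB isNil_lin coeff_sub coeff_one coeff_mul IsNil.mul_left
  from Literature.Combinatorics.Sahi2008.CumulationCone

namespace Summit.CriticalPhenomena.PercolationContinuityZ3.Theorems

namespace UCBernsteinUpper

open Finset Function
open Literature.Combinatorics.Sahi2008
open Literature.Combinatorics.Sahi2008.CycleForm
open Literature.Combinatorics.Sahi2008.SqFree (binomB lin IsNil Nonneg single)
open PrincipalCapBeta (phiSet realF realW)
open BernsteinPos UCBernsteinNested PhiScale

variable {n : ℕ}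

/-! ### Sahi's generating function of a set function and its multiplicativity -/

/-- The canonical weight is additive in the set function. [this work] -/
theorem realW_add (a b : Finset (Fin n) → ℝ) (S : Finset (Fin n)) :
    realW (fun T => a T + b T) S = realW a S + realW b S := by
  unfold PrincipalCapBeta.realW mobiusInv
  rw [← sum_add_distrib]
  exact sum_congr rfl fun X _ => by ring

/-- Off `∅` the weight does not see the normalisation. [this work] -/
theorem realW_nz_of_ne_empty (β : Finset (Fin n) → ℝ) {S : Finset (Fin n)} (hS : S ≠ ∅) : realW (fun S₀ : Finset (Fin _) => if S₀ = ∅ then (1 : ℝ) else β S₀) S = realW β S := by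
  unfold PrincipalCapBeta.realW mobiusInv
  refine sum_congr rfl fun X hX => ?_
  have hX' : X ⊆ univ \ S := mem_powerset.1 hX
  have hne : univ \ X ≠ ∅ := by
    obtain ⟨i, hi⟩ := nonempty_iff_ne_empty.2 hS
    have hiX : i ∉ X := fun h => (mem_sdiff.1 (hX' h)).2 hi
    exact nonempty_iff_ne_empty.1 ⟨i, mem_sdiff.2 ⟨mem_univ i, hiX⟩⟩
  dsimp only
  rw [if_neg hne]

/-- **Multiplicativity** `Z_{a+b} = Z_a · Z_b` (the defect identity at the level of generating functions). [this work] -/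
theorem Zf_add (a b : Finset (Fin n) → ℝ) : (∏ S₁, binomB
          (realW (fun S₀ : Finset (Fin _) => if S₀ = ∅ then (1 : ℝ) else (fun S => a S + b S) S₀) S₁) (lin realF S₁)) = (∏ S₁, binomB
          (realW (fun S₀ : Finset (Fin _) => if S₀ = ∅ then (1 : ℝ) else a S₀) S₁) (lin realF S₁)) * (∏ S₁, binomB
          (realW (fun S₀ : Finset (Fin _) => if S₀ = ∅ then (1 : ℝ) else b S₀) S₁) (lin realF S₁)) := by
  rw [← prod_mul_distrib]
  refine prod_congr rfl fun S _ => ?_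
  by_cases hS : S = ∅
  · subst hS
    rw [lin_realF_empty, binomB_zero_right, binomB_zero_right, binomB_zero_right, one_mul]
  · rw [realW_nz_of_ne_empty _ hS, realW_nz_of_ne_empty _ hS, realW_nz_of_ne_empty _ hS, realW_add,
      binomB_mul_binomB_same (isNil_lin realF S)]

/-- `1 − Z_β` has no constant term. [this work] -/
theorem isNil_one_sub_Zf (β : Finset (Fin n) → ℝ) : (1 - (∏ S₁, binomB
          (realW (fun S₀ : Finset (Fin _) => if S₀ = ∅ then (1 : ℝ) else β S₀) S₁) (lin realF S₁))).IsNil :=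
  isNil_one_sub_prod univ _ fun S _ => isNil_one_sub_binomB (isNil_lin realF S) _

/-- The coefficient of `t^τ` in `1 − Z_aZ_b`: `[t^τ](1−Z_a) + [t^τ](1−Z_b) − Σ_{σ⊆τ} [t^σ](1−Z_a)·[t^{τ∖σ}](1−Z_b)`. [this work] -/
theorem coeff_one_sub_mul (a b : Finset (Fin n) → ℝ) (τ : Finset (Fin n)) :
    (1 - (∏ S₁, binomB
          (realW (fun S₀ : Finset (Fin _) => if S₀ = ∅ then (1 : ℝ) else a S₀) S₁) (lin realF S₁)) * (∏ S₁, binomB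
          (realW (fun S₀ : Finset (Fin _) => if S₀ = ∅ then (1 : ℝ) else b S₀) S₁) (lin realF S₁))).coeff τ = (1 - (∏ S₁, binomB
          (realW (fun S₀ : Finset (Fin _) => if S₀ = ∅ then (1 : ℝ) else a S₀) S₁) (lin realF S₁))).coeff τ + (1 - (∏ S₁, binomB
          (realW (fun S₀ : Finset (Fin _) => if S₀ = ∅ then (1 : ℝ) else b S₀) S₁) (lin realF S₁))).coeff τ -
      ∑ σ ∈ τ.powerset, (1 - (∏ S₁, binomB
          (realW (fun S₀ : Finset (Fin _) => if S₀ = ∅ then (1 : ℝ) else a S₀) S₁) (lin realF S₁))).coeff σ * (1 - (∏ S₁, binomB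
          (realW (fun S₀ : Finset (Fin _) => if S₀ = ∅ then (1 : ℝ) else b S₀) S₁) (lin realF S₁))).coeff (τ \ σ) := by
  rw [← one_sub_add ((∏ S₁, binomB
          (realW (fun S₀ : Finset (Fin _) => if S₀ = ∅ then (1 : ℝ) else a S₀) S₁) (lin realF S₁))) ((∏ S₁, binomB
          (realW (fun S₀ : Finset (Fin _) => if S₀ = ∅ then (1 : ℝ) else b S₀) S₁) (lin realF S₁))), coeff_sub, coeff_mul]
  rfl

/-! ### Coefficients of `1 − Z_β` are honest sub-functionals -/

/-- **`[t^τ](1 − Z_β) = Φ_{k+1}(S ↦ β(e S))`** for an enumeration `e` of `τ` (`k+1 = |τ|`) chosen independently of `β`. [this work] -/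
theorem coeff_one_sub_Zf {τ : Finset (Fin n)} (hτ : τ.Nonempty) :
    ∃ (k : ℕ) (e : Fin (k + 1) ↪ Fin n), k + 1 = τ.card ∧ (∀ j, e j ∈ τ) ∧
      ∀ β : Finset (Fin n) → ℝ, (1 - (∏ S₁, binomB
          (realW (fun S₀ : Finset (Fin _) => if S₀ = ∅ then (1 : ℝ) else β S₀) S₁) (lin realF S₁))).coeff τ = phiSet (k + 1) (fun S => β (S.map e)) := by
  obtain ⟨k, hk⟩ := Nat.exists_eq_succ_of_ne_zero (card_ne_zero.2 hτ)
  let e : Fin (k + 1) ↪ Fin n :=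
    ⟨fun j => ((τ.equivFin.symm (Fin.cast hk.symm j) : τ) : Fin n), fun j j' h => by
      have h1 := Subtype.ext h
      have h2 := τ.equivFin.symm.injective h1
      exact Fin.cast_injective _ h2⟩
  refine ⟨k, e, hk.symm, fun j => (τ.equivFin.symm (Fin.cast hk.symm j)).2, fun β => ?_⟩
  have hco : (1 - (∏ S₁, binomB
          (realW (fun S₀ : Finset (Fin _) => if S₀ = ∅ then (1 : ℝ) else β S₀) S₁) (lin realF S₁))).coeff τ =
      sahiEOn (realW (fun S₀ : Finset (Fin _) => if S₀ = ∅ then (1 : ℝ) else β S₀)) τ realF := by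
    unfold SqFree.lin
    exact coeff_one_sub_prod_binomB_lin _ (sum_realW_norm1 β) realF τ
  rw [hco, sahiEOn]
  have hF : (fun i : Fin τ.card => (fun j : Fin (k + 1) => realF (e j)) (Fin.cast hk i)) =
      fun i => realF ((τ.equivFin.symm i : τ) : Fin n) := by
    funext i
    have hc : Fin.cast hk.symm (Fin.cast hk i) = i := Fin.ext (by simp)
    show realF ((τ.equivFin.symm (Fin.cast hk.symm (Fin.cast hk i)) : τ) : Fin n) = realF ((τ.equivFin.symm i : τ) : Fin n)
    rw [hc]
  have hre : sahiE (realW (fun S₀ : Finset (Fin _) => if S₀ = ∅ then (1 : ℝ) else β S₀)) τ.card (fun i => realF ((τ.equivFin.symm i : τ) : Fin n)) =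
      sahiE (realW (fun S₀ : Finset (Fin _) => if S₀ = ∅ then (1 : ℝ) else β S₀)) (k + 1) (fun j => realF (e j)) := by
    rw [← sahiE_cast _ hk (fun j => realF (e j)), hF]
  rw [hre, PrincipalCapBeta.sahiE_eq_phiSet]
  refine phiSet_congr fun B hB => ?_
  show ex (realW (fun S₀ : Finset (Fin _) => if S₀ = ∅ then (1 : ℝ) else β S₀)) (∏ x ∈ B, realF (e x)) = β (B.map e)
  rw [← Finset.prod_map B e realF, PrincipalCapBeta.ex_realW_prod]
  exact if_neg (hB.map).ne_empty

/-- **The top coefficient is the functional itself**: `[t^univ](1 − Z_β) = Φ_{n+1}(β)`. [this work] -/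
theorem coeff_univ_one_sub_Zf (β : Finset (Fin (n + 1)) → ℝ) : (1 - (∏ S₁, binomB
          (realW (fun S₀ : Finset (Fin _) => if S₀ = ∅ then (1 : ℝ) else β S₀) S₁) (lin realF S₁))).coeff univ = phiSet (n + 1) β := by
  have h1 : phiSet (n + 1) β = sahiE (realW (fun S₀ : Finset (Fin _) => if S₀ = ∅ then (1 : ℝ) else β S₀)) (n + 1) realF := by
    rw [PrincipalCapBeta.sahiE_eq_phiSet]
    refine phiSet_congr fun B hB => ?_
    rw [PrincipalCapBeta.ex_realW_prod]
    exact (if_neg hB.ne_empty).symm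
  rw [h1, sahiE_eq_gfE (realW (fun S₀ : Finset (Fin _) => if S₀ = ∅ then (1 : ℝ) else β S₀)) (sum_realW_norm1 β) (n + 1) realF]
  rfl

/-- **The defect identity** `Φ_{n+1}(a+b) = Φ_{n+1}(a) + Φ_{n+1}(b) − Σ_{σ} [t^σ](1−Z_a)·[t^{univ∖σ}](1−Z_b)`. [this work] -/
theorem phiSet_add_eq (a b : Finset (Fin (n + 1)) → ℝ) :
    phiSet (n + 1) (fun S => a S + b S) = phiSet (n + 1) a + phiSet (n + 1) b -
      ∑ σ ∈ (univ : Finset (Fin (n + 1))).powerset, (1 - (∏ S₁, binomB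
          (realW (fun S₀ : Finset (Fin _) => if S₀ = ∅ then (1 : ℝ) else a S₀) S₁) (lin realF S₁))).coeff σ * (1 - (∏ S₁, binomB
          (realW (fun S₀ : Finset (Fin _) => if S₀ = ∅ then (1 : ℝ) else b S₀) S₁) (lin realF S₁))).coeff (univ \ σ) := by
  rw [← coeff_univ_one_sub_Zf, ← coeff_univ_one_sub_Zf, ← coeff_univ_one_sub_Zf, Zf_add, coeff_one_sub_mul]

/-! ### Rays: the restricted coefficients are Bernstein-positive, and the single-family upper bound -/

/-- The ray through a union-closed family: `[t^σ](1 − Z_{w·1_𝒰})` is `BPos |σ|` in `w` (a ray of the pulled-back family). [this work] -/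
theorem bpos_coeff_ray (𝒰 : Finset (Finset (Fin n))) (hU : ∀ A ∈ 𝒰, ∀ B ∈ 𝒰, A ∪ B ∈ 𝒰) {σ : Finset (Fin n)} (hσ : σ.Nonempty) :
    BPos σ.card (fun w => (1 - (∏ S₁, binomB
          (realW (fun S₀ : Finset (Fin _) => if S₀ = ∅ then (1 : ℝ) else (fun S => w * (if S ∈ 𝒰 then (1 : ℝ) else 0)) S₀) S₁) (lin realF S₁))).coeff σ) := by
  obtain ⟨k, e, hk, _, h⟩ := coeff_one_sub_Zf hσ
  rw [← hk]
  refine (bpos_phiSet_ray (comap e 𝒰) (comap_unionClosed e 𝒰 hU)).congr fun w => ?_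
  rw [h]
  congr 1
  funext S
  by_cases hS : S.map e ∈ 𝒰
  · rw [if_pos hS, if_pos ((mem_comap e 𝒰 S).2 hS)]
  · rw [if_neg hS, if_neg (mt (mem_comap e 𝒰 S).1 hS)]

/-- The reflected ray: `[t^σ](1 − Z_{(1−w)·1_𝒱})` is `BPos |σ|` in `w`. [this work] -/
theorem bpos_coeff_ray' (𝒱 : Finset (Finset (Fin n))) (hV : ∀ A ∈ 𝒱, ∀ B ∈ 𝒱, A ∪ B ∈ 𝒱) {σ : Finset (Fin n)} (hσ : σ.Nonempty) :
    BPos σ.card (fun w => (1 - (∏ S₁, binomB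
          (realW (fun S₀ : Finset (Fin _) => if S₀ = ∅ then (1 : ℝ) else (fun S => (1 - w) * (if S ∈ 𝒱 then (1 : ℝ) else 0)) S₀) S₁) (lin realF S₁))).coeff σ) :=
  (bpos_coeff_ray 𝒱 hV hσ).reflect

/-- **Single-family upper bound**: `n!·w·[univ ∈ 𝒰] − Φ_{n+1}(w·1_𝒰)` is `BPos (n+1)` for union-closed `𝒰`
(block expansion along the last index; every non-top block contributes `(|B|−1)!·w[B∈𝒰]·(ray of the restricted family)`). [this work] -/
theorem bpos_top_sub_ray (𝒰 : Finset (Finset (Fin (n + 1)))) (hU : ∀ A ∈ 𝒰, ∀ B ∈ 𝒰, A ∪ B ∈ 𝒰) :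
    BPos (n + 1) (fun w => (n.factorial : ℝ) * (w * (if (univ : Finset (Fin (n + 1))) ∈ 𝒰 then (1 : ℝ) else 0)) -
      phiSet (n + 1) (fun S => w * (if S ∈ 𝒰 then (1 : ℝ) else 0))) := by
  -- the terms of the block expansion, with the top block's factor `coRest univ = 1` replaced by `1 − 1 = 0`
  have hterms : BPos (n + 1) (fun w => ∑ B ∈ univ.filter (fun B : Finset (Fin (n + 1)) => Fin.last n ∈ B),
      ((B.card - 1).factorial : ℝ) * ((w * (if B ∈ 𝒰 then (1 : ℝ) else 0)) *
        ((if B = univ then (1 : ℝ) else 0) - coRest (realW (fun S => w * (if S ∈ 𝒰 then (1 : ℝ) else 0))) realF B))) := by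
    refine BPos.sum _ (fun B w => ((B.card - 1).factorial : ℝ) * ((w * (if B ∈ 𝒰 then (1 : ℝ) else 0)) *
        ((if B = univ then (1 : ℝ) else 0) - coRest (realW (fun S => w * (if S ∈ 𝒰 then (1 : ℝ) else 0))) realF B))) fun B hB => ?_
    have hlB : Fin.last n ∈ B := (mem_filter.1 hB).2
    by_cases hBu : B = univ
    · refine bpos_zero.congr fun w => ?_
      rw [if_pos hBu, hBu, coRest_univ, sub_self, mul_zero, mul_zero]
    · obtain ⟨m, e, he, hc⟩ := exists_emb_coRest hBu
      have hm : m < n := PhiVertex.lt_of_emb_ne_last e fun j hj => he j (by rw [hj]; exact hlB)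
      have hray : BPos (m + 1) (fun w => phiSet (m + 1) (fun S => w * (if S.map e ∈ 𝒰 then (1 : ℝ) else 0))) := by
        refine (bpos_phiSet_ray (comap e 𝒰) (comap_unionClosed e 𝒰 hU)).congr fun w => ?_
        congr 1; funext S
        by_cases hS : S.map e ∈ 𝒰
        · rw [if_pos hS, if_pos ((mem_comap e 𝒰 S).2 hS)]
        · rw [if_neg hS, if_neg (mt (mem_comap e 𝒰 S).1 hS)]
      have hfac : BPos 1 (fun w : ℝ => w * (if B ∈ 𝒰 then (1 : ℝ) else 0)) := by
        by_cases hBU : B ∈ 𝒰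
        · exact bpos_id.congr fun w => by rw [if_pos hBU, mul_one]
        · exact bpos_zero.congr fun w => by rw [if_neg hBU, mul_zero]
      have hprod := ((hfac.mul hray).mono (show 1 + (m + 1) ≤ n + 1 by omega)).smul (Nat.cast_nonneg (B.card - 1).factorial)
      refine hprod.congr fun w => ?_
      rw [if_neg hBu, hc, zero_sub, neg_neg]
  refine hterms.congr fun w => ?_
  rw [phiSet_eq_sum_blocks_last]
  have hsplit : ∀ B ∈ univ.filter (fun B : Finset (Fin (n + 1)) => Fin.last n ∈ B),
      ((B.card - 1).factorial : ℝ) * ((w * (if B ∈ 𝒰 then (1 : ℝ) else 0)) *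
        ((if B = univ then (1 : ℝ) else 0) - coRest (realW (fun S => w * (if S ∈ 𝒰 then (1 : ℝ) else 0))) realF B)) =
      ((B.card - 1).factorial : ℝ) * ((w * (if B ∈ 𝒰 then (1 : ℝ) else 0)) * (if B = univ then (1 : ℝ) else 0)) -
      ((B.card - 1).factorial : ℝ) * ((w * (if B ∈ 𝒰 then (1 : ℝ) else 0)) *
        coRest (realW (fun S => w * (if S ∈ 𝒰 then (1 : ℝ) else 0))) realF B) := fun B _ => by ring
  rw [sum_congr rfl hsplit, sum_sub_distrib]
  congr 1
  have hmem : (univ : Finset (Fin (n + 1))) ∈ univ.filter (fun B : Finset (Fin (n + 1)) => Fin.last n ∈ B) :=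
    mem_filter.2 ⟨mem_univ _, mem_univ (Fin.last n)⟩
  rw [Finset.sum_eq_single_of_mem (univ : Finset (Fin (n + 1))) hmem (fun B _ hB => by rw [if_neg hB, mul_zero, mul_zero])]
  rw [if_pos rfl, mul_one, card_univ, Fintype.card_fin, Nat.add_sub_cancel]

/-! ### The theorem -/

/-- **UPPER BOUND (every order, every pair of union-closed families): `w ↦ n!·β_w(univ) − Φ_{n+1}(β_w)` is `BPos (n+1)`**,
`β_w = w·1_𝒰 + (1−w)·1_𝒱`; i.e. `P_T ≤_B (|T|−1)!·β_T` coefficientwise in the Bernstein basis. [this work] -/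
theorem bpos_top_sub_phiSet_mix (𝒰 𝒱 : Finset (Finset (Fin (n + 1)))) (hU : ∀ A ∈ 𝒰, ∀ B ∈ 𝒰, A ∪ B ∈ 𝒰)
    (hV : ∀ A ∈ 𝒱, ∀ B ∈ 𝒱, A ∪ B ∈ 𝒱) :
    BPos (n + 1) (fun w => (n.factorial : ℝ) * mix 𝒰 𝒱 w univ - phiSet (n + 1) (mix 𝒰 𝒱 w)) := by
  have hA := bpos_top_sub_ray 𝒰 hU
  have hB := (bpos_top_sub_ray 𝒱 hV).reflect
  have hX : BPos (n + 1) (fun w => ∑ σ ∈ (univ : Finset (Fin (n + 1))).powerset,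
      (1 - (∏ S₁, binomB
          (realW (fun S₀ : Finset (Fin _) => if S₀ = ∅ then (1 : ℝ) else (fun S => w * (if S ∈ 𝒰 then (1 : ℝ) else 0)) S₀) S₁) (lin realF S₁))).coeff σ *
        (1 - (∏ S₁, binomB
          (realW (fun S₀ : Finset (Fin _) => if S₀ = ∅ then (1 : ℝ) else (fun S => (1 - w) * (if S ∈ 𝒱 then (1 : ℝ) else 0)) S₀) S₁) (lin realF S₁))).coeff (univ \ σ)) := by
    refine BPos.sum _ (fun σ w => (1 - (∏ S₁, binomB
          (realW (fun S₀ : Finset (Fin _) => if S₀ = ∅ then (1 : ℝ) else (fun S => w * (if S ∈ 𝒰 then (1 : ℝ) else 0)) S₀) S₁) (lin realF S₁))).coeff σ *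
        (1 - (∏ S₁, binomB
          (realW (fun S₀ : Finset (Fin _) => if S₀ = ∅ then (1 : ℝ) else (fun S => (1 - w) * (if S ∈ 𝒱 then (1 : ℝ) else 0)) S₀) S₁) (lin realF S₁))).coeff (univ \ σ)) fun σ _ => ?_
    by_cases h0 : σ = ∅
    · refine bpos_zero.congr fun w => ?_
      rw [h0, show (1 - (∏ S₁, binomB
          (realW (fun S₀ : Finset (Fin _) => if S₀ = ∅ then (1 : ℝ) else (fun S : Finset (Fin (n + 1)) => w * (if S ∈ 𝒰 then (1 : ℝ) else 0)) S₀) S₁) (lin realF S₁))).coeff ∅ = 0 from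
        isNil_one_sub_Zf _, zero_mul]
    by_cases h1 : σ = univ
    · refine bpos_zero.congr fun w => ?_
      rw [h1, sdiff_self, show (1 - (∏ S₁, binomB
          (realW (fun S₀ : Finset (Fin _) => if S₀ = ∅ then (1 : ℝ) else (fun S : Finset (Fin (n + 1)) => (1 - w) * (if S ∈ 𝒱 then (1 : ℝ) else 0)) S₀) S₁) (lin realF S₁))).coeff
        (⊥ : Finset (Fin (n + 1))) = 0 from isNil_one_sub_Zf _, mul_zero]
    · have hσ : σ.Nonempty := nonempty_iff_ne_empty.2 h0
      have hσc : (univ \ σ).Nonempty := by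
        refine nonempty_iff_ne_empty.2 fun h => h1 ?_
        exact eq_univ_of_forall fun x => by
          by_contra hx
          have : x ∈ univ \ σ := mem_sdiff.2 ⟨mem_univ x, hx⟩
          rw [h] at this; exact notMem_empty x this
      have hcard : σ.card + (univ \ σ).card = n + 1 := by
        rw [card_univ_sdiff, Fintype.card_fin]
        have : σ.card ≤ n + 1 := (card_le_univ σ).trans (by rw [Fintype.card_fin])
        omega
      exact ((bpos_coeff_ray 𝒰 hU hσ).mul (bpos_coeff_ray' 𝒱 hV hσc)).mono hcard.le
  refine ((hA.add hB).add hX).congr fun w => ?_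
  have hmix : mix 𝒰 𝒱 w = fun S => (w * (if S ∈ 𝒰 then (1 : ℝ) else 0)) + ((1 - w) * (if S ∈ 𝒱 then (1 : ℝ) else 0)) := rfl
  rw [hmix, phiSet_add_eq]
  ring

/-- **The doubly-top-free SIGN LAW (every order)**: if `univ ∉ 𝒰` and `univ ∉ 𝒱` then `−P` is `BPos (n+1)`, i.e. every degree-`(n+1)`
Bernstein coefficient of the edge polynomial is `≤ 0`. [this work] -/
theorem bpos_neg_phiSet_mix_of_topFree (𝒰 𝒱 : Finset (Finset (Fin (n + 1)))) (hU : ∀ A ∈ 𝒰, ∀ B ∈ 𝒰, A ∪ B ∈ 𝒰)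
    (hV : ∀ A ∈ 𝒱, ∀ B ∈ 𝒱, A ∪ B ∈ 𝒱) (htU : univ ∉ 𝒰) (htV : univ ∉ 𝒱) :
    BPos (n + 1) (fun w => -phiSet (n + 1) (mix 𝒰 𝒱 w)) := by
  refine (bpos_top_sub_phiSet_mix 𝒰 𝒱 hU hV).congr fun w => ?_
  unfold mix
  rw [if_neg htU, if_neg htV, mul_zero, mul_zero, add_zero, mul_zero, zero_sub]

/-- Pointwise form of the upper bound on the edge: `Φ_{n+1}(β_w) ≤ n!·β_w(univ)` for `w ∈ [0,1]`. [this work] -/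
theorem phiSet_mix_le_top (𝒰 𝒱 : Finset (Finset (Fin (n + 1)))) (hU : ∀ A ∈ 𝒰, ∀ B ∈ 𝒰, A ∪ B ∈ 𝒰)
    (hV : ∀ A ∈ 𝒱, ∀ B ∈ 𝒱, A ∪ B ∈ 𝒱) {w : ℝ} (hw0 : 0 ≤ w) (hw1 : w ≤ 1) :
    phiSet (n + 1) (mix 𝒰 𝒱 w) ≤ (n.factorial : ℝ) * mix 𝒰 𝒱 w univ :=
  sub_nonneg.1 ((bpos_top_sub_phiSet_mix 𝒰 𝒱 hU hV).nonneg hw0 hw1)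

/-- Pointwise doubly-top-free sign law on the edge: `Φ_{n+1}(β_w) ≤ 0` for `w ∈ [0,1]` when `univ ∉ 𝒰 ∪ 𝒱`. [this work] -/
theorem phiSet_mix_nonpos_of_topFree (𝒰 𝒱 : Finset (Finset (Fin (n + 1)))) (hU : ∀ A ∈ 𝒰, ∀ B ∈ 𝒰, A ∪ B ∈ 𝒰)
    (hV : ∀ A ∈ 𝒱, ∀ B ∈ 𝒱, A ∪ B ∈ 𝒱) (htU : univ ∉ 𝒰) (htV : univ ∉ 𝒱) {w : ℝ} (hw0 : 0 ≤ w) (hw1 : w ≤ 1) :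
    phiSet (n + 1) (mix 𝒰 𝒱 w) ≤ 0 :=
  neg_nonneg.1 ((bpos_neg_phiSet_mix_of_topFree 𝒰 𝒱 hU hV htU htV).nonneg hw0 hw1)

end UCBernsteinUpper

end Summit.CriticalPhenomena.PercolationContinuityZ3.Theorems
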